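import Literature.AnabelianGeometry.SemiGraphs.PSCCompactifiedLevelBridgeNodes
import HarnessLib

/-!
# [CombGC] Thm. 1.6 (ii), descent step: it suffices to match the vertex [node] sets of the coverings at the
# levels BELOW A STURDY LEVEL `U₀` (cofinal variants of the level-wise descent)

Mochizuki, *A combinatorial version of the Grothendieck conjecture*, Tohoku Math. J. **59** (2007) [CombGC],
proof of Theorem 1.6 (ii), author's ms p. 14 l.12–16 ("we may always replace `G`, `H` by finite étale
`Π_G`- or `Π_H`-coverings that correspond via `α`.  In particular, by Remark 1.1.5, we may assume without loss
of generality that `G`, `H` are sturdy") and l.25–28 ("it suffices to prove … that `α` induces a functorial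
bijection between the sets of vertices of `G`, `H`"), render `paper:url-6994f81053dc` p0014.
[cite: MochizukiCombGC2007, Thm 1.6(ii) p.14]

PROOF-ONLY file (abc-iut cell, layer L3, `plan/L3/SUBDAG-CombGC-Thm16.md` row T16-L09b, holder
abc-iut-w5-d188; for the writer's ROUTE 2 composition "sturdy level `U₀` + route 2 per `U ≤ U₀`").  The
all-levels descent theorems `transport_iff_levelwise` (p420865), `transport_of_equivariant_bijections`
(p421305) and `transport_of_graphic_mod` (p421678) ask for data at EVERY open normal level `U` of `Π_G`; the
sturdiness needed for Prop. 1.2 (i) (unramified case) is only available below a sturdy characteristic level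
`U₀` (Rmk. 1.1.5).  Since the open normal subgroups `U ≤ U₀` are COFINAL, the data below `U₀` suffice — and the
reduction is formal: the level-`U ⊓ U₀` correspondence of stabilizers implies the level-`U` one
(`U ⊔ (U ⊓ U₀ ⊔ X) = U ⊔ X`).  Contents: `transport_of_levelwise_le` (stabilizer correspondence for `U ≤ U₀`
⇒ transport of classes), `transport_of_equivariant_bijections_le`, **`transport_of_graphic_mod_le`**, and the
corollaries **`isGroupTheoreticallyVerticial_of_graphic_mod_le`**, **`nodal_transport_of_graphic_mod_le`**
— the hypotheses of `PSCUnrLevelPackage.graphic_mod_package_unr` / `PSCCompactifiedNodePackage…` need only be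
supplied at the levels `U ≤ U₀`, WITHOUT passing to the covering `G_{U₀}` (no nested coverings).  Pure group
theory; no definitions; nothing here takes a side on [IUTchIII] Cor. 3.12.
-/

noncomputable section

namespace Literature.AnabelianGeometry.SemiGraphs

namespace PSCDatum

open scoped Pointwise

universe u

variable {P : Type u} [Group P] [TopologicalSpace P]
variable {P' : Type u} [Group P'] [TopologicalSpace P']
variable [IsTopologicalGroup P] [CompactSpace P] [TotallyDisconnectedSpace P]
variable [IsTopologicalGroup P'] [CompactSpace P'] [TotallyDisconnectedSpace P']
variable (α : P ≃ₜ* P')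

omit [TopologicalSpace P] [TopologicalSpace P'] [IsTopologicalGroup P] [CompactSpace P] [TotallyDisconnectedSpace P]
  [IsTopologicalGroup P'] [CompactSpace P'] [TotallyDisconnectedSpace P'] in
/-- `α(α⁻¹(B')) = B'`. [cite: MochizukiCombGC2007, Def 1.4 p.10] -/
private theorem map_map_symm'' (α : P ≃* P') (B' : Subgroup P') :
    (B'.map α.symm.toMonoidHom).map α.toMonoidHom = B' := by
  rw [Subgroup.map_map]
  convert Subgroup.map_id B'
  ext x
  exact α.apply_symm_apply x

/-- **Stabilizer correspondence below a level `U₀` suffices.**  If `U₀` is open normal in `Π_G` and for every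
open normal `U ≤ U₀` and every `V ≥ U`: `V` is an `S`-stabilizer `U ⊔ γ • S i` iff `α(V)` is a `T`-stabilizer
`α(U) ⊔ δ • T j`, then `α` carries the `Π_G`-conjugates of the `S i` onto the `Π_H`-conjugates of the `T j` and
every such conjugate arises (the levels `U ≤ U₀` are cofinal; the level-`U ⊓ U₀` correspondence gives the
level-`U` one). [cite: MochizukiCombGC2007, Thm 1.6(ii) p.14] -/
theorem transport_of_levelwise_le {ι ι' : Type*} [Finite ι] [Finite ι'] (S : ι → Subgroup P)
    (hS : ∀ i, IsClosed ((S i : Subgroup P) : Set P)) (T : ι' → Subgroup P')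
    (hT : ∀ j, IsClosed ((T j : Subgroup P') : Set P')) {U₀ : Subgroup P} (hU₀n : U₀.Normal)
    (hU₀o : IsOpen (U₀ : Set P))
    (h : ∀ U : Subgroup P, U.Normal → IsOpen (U : Set P) → U ≤ U₀ → ∀ V : Subgroup P, U ≤ V →
      ((∃ (i : ι) (γ : ConjAct P), V = U ⊔ γ • S i) ↔
        ∃ (j : ι') (δ : ConjAct P'),
          V.map α.toMulEquiv.toMonoidHom = U.map α.toMulEquiv.toMonoidHom ⊔ δ • T j)) :
    (∀ A : Subgroup P, (∃ (i : ι) (γ : ConjAct P), A = γ • S i) →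
        ∃ (j : ι') (δ : ConjAct P'), A.map α.toMulEquiv.toMonoidHom = δ • T j) ∧
      ∀ B : Subgroup P', (∃ (j : ι') (δ : ConjAct P'), B = δ • T j) →
        ∃ A : Subgroup P, (∃ (i : ι) (γ : ConjAct P), A = γ • S i) ∧
          A.map α.toMulEquiv.toMonoidHom = B := by
  haveI := hU₀n
  refine (transport_iff_levelwise α S hS T hT).mpr fun U hUn hUo V hUV => ?_
  haveI := hUn
  -- the auxiliary level `W := U ⊓ U₀ ≤ U₀`
  have hWn : (U ⊓ U₀).Normal := inferInstance
  have hWo : IsOpen ((U ⊓ U₀ : Subgroup P) : Set P) := by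
    rw [Subgroup.coe_inf]; exact hUo.inter hU₀o
  have hWU : U ⊓ U₀ ≤ U := inf_le_left
  constructor
  · rintro ⟨i, γ, rfl⟩
    obtain ⟨j, δ, hj⟩ := (h _ hWn hWo inf_le_right (U ⊓ U₀ ⊔ γ • S i) le_sup_left).mp ⟨i, γ, rfl⟩
    refine ⟨j, δ, ?_⟩
    have hV : U ⊔ γ • S i = U ⊔ (U ⊓ U₀ ⊔ γ • S i) := by
      rw [← sup_assoc, sup_eq_left.mpr hWU]
    rw [hV, Subgroup.map_sup, hj, ← sup_assoc, sup_eq_left.mpr (Subgroup.map_mono hWU)]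
  · rintro ⟨j, δ, hV⟩
    -- `V' := W ⊔ α⁻¹(δ T j)` has `α(V') = α(W) ⊔ δ T j`
    have hV' : (U ⊓ U₀ ⊔ (δ • T j).map α.symm.toMulEquiv.toMonoidHom).map α.toMulEquiv.toMonoidHom =
        (U ⊓ U₀).map α.toMulEquiv.toMonoidHom ⊔ δ • T j := by
      rw [Subgroup.map_sup]
      congr 1
      exact map_map_symm'' α.toMulEquiv (δ • T j)
    obtain ⟨i, γ, hi⟩ := (h _ hWn hWo inf_le_right _ le_sup_left).mpr ⟨j, δ, hV'⟩
    refine ⟨i, γ, ?_⟩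
    apply Subgroup.map_injective (f := α.toMulEquiv.toMonoidHom) α.injective
    have : U ⊔ γ • S i = U ⊔ (U ⊓ U₀ ⊔ (δ • T j).map α.symm.toMulEquiv.toMonoidHom) := by
      rw [hi, ← sup_assoc, sup_eq_left.mpr hWU]
    rw [this, Subgroup.map_sup, hV', ← sup_assoc, sup_eq_left.mpr (Subgroup.map_mono hWU), hV]

/-- **Equivariant bijections of `S`/`T`-objects at the levels `U ≤ U₀` suffice** (cofinal variant of
`transport_of_equivariant_bijections`, p421305). [cite: MochizukiCombGC2007, Thm 1.6(ii) p.14] -/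
theorem transport_of_equivariant_bijections_le {ι ι' : Type*} [Finite ι] [Finite ι']
    (S : ι → Subgroup P) (hS : ∀ i, IsClosed ((S i : Subgroup P) : Set P)) (T : ι' → Subgroup P')
    (hT : ∀ j, IsClosed ((T j : Subgroup P') : Set P')) {U₀ : Subgroup P} (hU₀n : U₀.Normal)
    (hU₀o : IsOpen (U₀ : Set P))
    (h : ∀ U : Subgroup P, U.Normal → IsOpen (U : Set P) → U ≤ U₀ →
      ∃ e : (Σ i, DoubleCoset.Quotient (U : Set P) (S i : Set P)) ≃
          (Σ j, DoubleCoset.Quotient ((U.map α.toMulEquiv.toMonoidHom : Subgroup P') : Set P')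
            (T j : Set P')),
        ∀ (g x : P) (i : ι) (j : ι') (y : P'),
          e ⟨i, DoubleCoset.mk U (S i) x⟩ = ⟨j, DoubleCoset.mk (U.map α.toMulEquiv.toMonoidHom) (T j) y⟩ →
            e ⟨i, DoubleCoset.mk U (S i) (g * x)⟩ =
              ⟨j, DoubleCoset.mk (U.map α.toMulEquiv.toMonoidHom) (T j) (α g * y)⟩) :
    (∀ A : Subgroup P, (∃ (i : ι) (γ : ConjAct P), A = γ • S i) →
        ∃ (j : ι') (δ : ConjAct P'), A.map α.toMulEquiv.toMonoidHom = δ • T j) ∧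
      ∀ B : Subgroup P', (∃ (j : ι') (δ : ConjAct P'), B = δ • T j) →
        ∃ A : Subgroup P, (∃ (i : ι) (γ : ConjAct P), A = γ • S i) ∧
          A.map α.toMulEquiv.toMonoidHom = B := by
  refine transport_of_levelwise_le α S hS T hT hU₀n hU₀o fun U hUn hUo hUU₀ V hUV => ?_
  obtain ⟨e, he⟩ := h U hUn hUo hUU₀
  exact stabilizers_correspond_of_equivariant_bijection α S T hUn
    (Subgroup.Normal.map hUn _ α.surjective) rfl e he V hUV

/-- **`α`-graphic-mod-`K'_U` bijections with separation at the levels `U ≤ U₀` suffice** (cofinal variant of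
`transport_of_graphic_mod`, p421678): the shape produced per level by `PSCUnrLevelPackage.graphic_mod_package_unr`
(vertices, `K' = Ker(↠ Π^unr)↑`) and by the node packages (`K' = Ker(↠ Π^cpt)↑`), to be supplied only below a
sturdy characteristic level `U₀`. [cite: MochizukiCombGC2007, Thm 1.6(ii) p.14] -/
theorem transport_of_graphic_mod_le {ι ι' : Type*} [Finite ι] [Finite ι'] (S : ι → Subgroup P)
    (hS : ∀ i, IsClosed ((S i : Subgroup P) : Set P)) (T : ι' → Subgroup P')
    (hT : ∀ j, IsClosed ((T j : Subgroup P') : Set P')) {U₀ : Subgroup P} (hU₀n : U₀.Normal)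
    (hU₀o : IsOpen (U₀ : Set P))
    (h : ∀ U : Subgroup P, U.Normal → IsOpen (U : Set P) → U ≤ U₀ →
      ∃ (K' : Subgroup P') (_ : K'.Normal)
        (e : (Σ i, DoubleCoset.Quotient (U : Set P) (S i : Set P)) ≃
          (Σ j, DoubleCoset.Quotient ((U.map α.toMulEquiv.toMonoidHom : Subgroup P') : Set P')
            (T j : Set P'))),
        (∀ (i : ι) (x : P) (j : ι') (y : P'),
          e ⟨i, DoubleCoset.mk U (S i) x⟩ = ⟨j, DoubleCoset.mk (U.map α.toMulEquiv.toMonoidHom) (T j) y⟩ →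
            ∃ u' ∈ U.map α.toMulEquiv.toMonoidHom,
              (U ⊓ ConjAct.toConjAct x • S i).map α.toMulEquiv.toMonoidHom ⊔ K' =
                ConjAct.toConjAct u' •
                  ((U.map α.toMulEquiv.toMonoidHom ⊓ ConjAct.toConjAct y • T j) ⊔ K')) ∧
        (∀ (j₁ : ι') (y₁ : P') (j₂ : ι') (y₂ : P'),
          (∃ u' ∈ U.map α.toMulEquiv.toMonoidHom,
              (U.map α.toMulEquiv.toMonoidHom ⊓ ConjAct.toConjAct y₁ • T j₁) ⊔ K' =
                ConjAct.toConjAct u' •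
                  ((U.map α.toMulEquiv.toMonoidHom ⊓ ConjAct.toConjAct y₂ • T j₂) ⊔ K')) →
            (⟨j₁, DoubleCoset.mk (U.map α.toMulEquiv.toMonoidHom) (T j₁) y₁⟩ :
                Σ j, DoubleCoset.Quotient ((U.map α.toMulEquiv.toMonoidHom : Subgroup P') : Set P')
                  (T j : Set P')) =
              ⟨j₂, DoubleCoset.mk (U.map α.toMulEquiv.toMonoidHom) (T j₂) y₂⟩)) :
    (∀ A : Subgroup P, (∃ (i : ι) (γ : ConjAct P), A = γ • S i) →
        ∃ (j : ι') (δ : ConjAct P'), A.map α.toMulEquiv.toMonoidHom = δ • T j) ∧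
      ∀ B : Subgroup P', (∃ (j : ι') (δ : ConjAct P'), B = δ • T j) →
        ∃ A : Subgroup P, (∃ (i : ι) (γ : ConjAct P), A = γ • S i) ∧
          A.map α.toMulEquiv.toMonoidHom = B := by
  refine transport_of_equivariant_bijections_le α S hS T hT hU₀n hU₀o fun U hUn hUo hUU₀ => ?_
  obtain ⟨K', hK', e, he, hsep⟩ := h U hUn hUo hUU₀
  exact ⟨e, fun g x i j y hxy => equivariant_of_graphic_mod α S T hUn
    (Subgroup.Normal.map hUn _ α.surjective) hK' e he hsep g x i j y hxy⟩

variable (G : PSCDatum P) (H : PSCDatum P')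

/-- **Vertices, below a sturdy level**: `α`-graphic-mod-`K'_U` VERTEX bijections with separation at the open
normal levels `U ≤ U₀` ⇒ `α` group-theoretically verticial. [cite: MochizukiCombGC2007, Thm 1.6(ii) p.14] -/
theorem isGroupTheoreticallyVerticial_of_graphic_mod_le {U₀ : Subgroup P} (hU₀n : U₀.Normal)
    (hU₀o : IsOpen (U₀ : Set P))
    (h : ∀ U : Subgroup P, U.Normal → IsOpen (U : Set P) → U ≤ U₀ →
      ∃ (K' : Subgroup P') (_ : K'.Normal)
        (e : (Σ v, DoubleCoset.Quotient (U : Set P) (G.vertGp v : Set P)) ≃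
          (Σ w, DoubleCoset.Quotient ((U.map α.toMulEquiv.toMonoidHom : Subgroup P') : Set P')
            (H.vertGp w : Set P'))),
        (∀ (v : G.graph.V) (x : P) (w : H.graph.V) (y : P'),
          e ⟨v, DoubleCoset.mk U (G.vertGp v) x⟩ =
              ⟨w, DoubleCoset.mk (U.map α.toMulEquiv.toMonoidHom) (H.vertGp w) y⟩ →
            ∃ u' ∈ U.map α.toMulEquiv.toMonoidHom,
              (U ⊓ ConjAct.toConjAct x • G.vertGp v).map α.toMulEquiv.toMonoidHom ⊔ K' =
                ConjAct.toConjAct u' •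
                  ((U.map α.toMulEquiv.toMonoidHom ⊓ ConjAct.toConjAct y • H.vertGp w) ⊔ K')) ∧
        (∀ (w₁ : H.graph.V) (y₁ : P') (w₂ : H.graph.V) (y₂ : P'),
          (∃ u' ∈ U.map α.toMulEquiv.toMonoidHom,
              (U.map α.toMulEquiv.toMonoidHom ⊓ ConjAct.toConjAct y₁ • H.vertGp w₁) ⊔ K' =
                ConjAct.toConjAct u' •
                  ((U.map α.toMulEquiv.toMonoidHom ⊓ ConjAct.toConjAct y₂ • H.vertGp w₂) ⊔ K')) →
            (⟨w₁, DoubleCoset.mk (U.map α.toMulEquiv.toMonoidHom) (H.vertGp w₁) y₁⟩ :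
                Σ w, DoubleCoset.Quotient ((U.map α.toMulEquiv.toMonoidHom : Subgroup P') : Set P')
                  (H.vertGp w : Set P')) =
              ⟨w₂, DoubleCoset.mk (U.map α.toMulEquiv.toMonoidHom) (H.vertGp w₂) y₂⟩)) :
    G.IsGroupTheoreticallyVerticial H α := by
  obtain ⟨h₁, h₂⟩ := transport_of_graphic_mod_le α G.vertGp G.isClosed_vertGp H.vertGp H.isClosed_vertGp
    hU₀n hU₀o h
  exact ⟨fun A ⟨v, γ, hA⟩ => by obtain ⟨w, δ, h'⟩ := h₁ A ⟨v, γ, hA⟩; exact ⟨w, δ, h'⟩,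
    fun B ⟨w, δ, hB⟩ => by
      obtain ⟨A, ⟨v, γ, hA⟩, hAB⟩ := h₂ B ⟨w, δ, hB⟩; exact ⟨A, ⟨v, γ, hA⟩, hAB⟩⟩

/-- **Nodes, below a sturdy level**: `α`-graphic-mod-`K'_U` NODE bijections with separation at the open normal
levels `U ≤ U₀` ⇒ `α` carries nodal classes to nodal classes and back (then Thm. 1.6 (i) gives
group-theoretic edge-likeness, `isGroupTheoreticallyEdgeLike_of_nodal_of_cuspidal`).
[cite: MochizukiCombGC2007, Thm 1.6(ii) p.14] -/
theorem nodal_transport_of_graphic_mod_le {U₀ : Subgroup P} (hU₀n : U₀.Normal) (hU₀o : IsOpen (U₀ : Set P))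
    (h : ∀ U : Subgroup P, U.Normal → IsOpen (U : Set P) → U ≤ U₀ →
      ∃ (K' : Subgroup P') (_ : K'.Normal)
        (e : (Σ n, DoubleCoset.Quotient (U : Set P) (G.nodeGp n : Set P)) ≃
          (Σ m, DoubleCoset.Quotient ((U.map α.toMulEquiv.toMonoidHom : Subgroup P') : Set P')
            (H.nodeGp m : Set P'))),
        (∀ (n : G.graph.N) (x : P) (m : H.graph.N) (y : P'),
          e ⟨n, DoubleCoset.mk U (G.nodeGp n) x⟩ =
              ⟨m, DoubleCoset.mk (U.map α.toMulEquiv.toMonoidHom) (H.nodeGp m) y⟩ →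
            ∃ u' ∈ U.map α.toMulEquiv.toMonoidHom,
              (U ⊓ ConjAct.toConjAct x • G.nodeGp n).map α.toMulEquiv.toMonoidHom ⊔ K' =
                ConjAct.toConjAct u' •
                  ((U.map α.toMulEquiv.toMonoidHom ⊓ ConjAct.toConjAct y • H.nodeGp m) ⊔ K')) ∧
        (∀ (m₁ : H.graph.N) (y₁ : P') (m₂ : H.graph.N) (y₂ : P'),
          (∃ u' ∈ U.map α.toMulEquiv.toMonoidHom,
              (U.map α.toMulEquiv.toMonoidHom ⊓ ConjAct.toConjAct y₁ • H.nodeGp m₁) ⊔ K' =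
                ConjAct.toConjAct u' •
                  ((U.map α.toMulEquiv.toMonoidHom ⊓ ConjAct.toConjAct y₂ • H.nodeGp m₂) ⊔ K')) →
            (⟨m₁, DoubleCoset.mk (U.map α.toMulEquiv.toMonoidHom) (H.nodeGp m₁) y₁⟩ :
                Σ m, DoubleCoset.Quotient ((U.map α.toMulEquiv.toMonoidHom : Subgroup P') : Set P')
                  (H.nodeGp m : Set P')) =
              ⟨m₂, DoubleCoset.mk (U.map α.toMulEquiv.toMonoidHom) (H.nodeGp m₂) y₂⟩)) :
    (∀ A, G.IsNodal A → H.IsNodal (A.map α.toMulEquiv.toMonoidHom)) ∧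
      ∀ B, H.IsNodal B → ∃ A, G.IsNodal A ∧ A.map α.toMulEquiv.toMonoidHom = B := by
  obtain ⟨h₁, h₂⟩ := transport_of_graphic_mod_le α G.nodeGp G.isClosed_nodeGp H.nodeGp H.isClosed_nodeGp
    hU₀n hU₀o h
  exact ⟨fun A ⟨n, γ, hA⟩ => by obtain ⟨m, δ, h'⟩ := h₁ A ⟨n, γ, hA⟩; exact ⟨m, δ, h'⟩,
    fun B ⟨m, δ, hB⟩ => by
      obtain ⟨A, ⟨n, γ, hA⟩, hAB⟩ := h₂ B ⟨m, δ, hB⟩; exact ⟨A, ⟨n, γ, hA⟩, hAB⟩⟩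

end PSCDatum

end Literature.AnabelianGeometry.SemiGraphs
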